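/-
Copyright: pub-balaban β-flow team, BINDER row D4 OWNER (unit `b2b-balaban-beta-an4`).  ROW-D4 JUNCTION with the
statement-exact typing `Balaban1983to89.B12BetaAsPrinted` of [I] = CMP 109 (typer `b2b-balaban-beta-asprinted`): which of the
row's one-loop-split letters the as-printed interface SUPPLIES BY NAME, composed on the interface (def-free bookkeeping).
NOTHING of [I] is asserted or proved here; (D4) is NOT discharged by anything in this file.
-/
import Mathlib
import Literature.MathematicalPhysics.QuantumFieldTheory.Balaban1983to89.B12BetaAsPrinted
import Literature.MathematicalPhysics.QuantumFieldTheory.Balaban1983to89.T4RateAlgebra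

/-!
# Row-D4 junction with `B12BetaAsPrinted` — the one-loop split letters ON THE INTERFACE

BINDER row D4 reads the β-functions of [Balaban1987RG1] through the printed ONE-LOOP SPLIT `B12Beta.OneLoopSplit`
(`β_{k+1} = β⁰_{k+1} + β¹_{k+1}(g₀, …, g_k)`, `β¹_{k+1} = 0` at `g_k = 0`; (1.3)∕(1.6) pp. 260–261, (2.13)–(2.14) p. 268) and the
remainder letters of `Beta.RemainderChain`.  The row's interface needs N-D4-1…5 (`run/shared/lean/pub/pub-balaban/INBOX.md`
l.12733) were typed by `B12BetaAsPrinted` (three term slots `logZ ∕ Eint ∕ Ebold` with `Definitions.d13`∕`d120split`; the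
p. 268 sentence `d213`; the (5.10)-SCHEMA `Conclusions.c510` with the (1.18)-constant a binder and its printed instance `c118`;
the p. 264 clause `c264`; history typing `FlowStep.HBeta`).  This file composes them, BY NAME, into the β-level statements the
row consumes:

* §0 kernel bookkeeping [folklore]: `secondMoment_add` (the lattice sum (1.22) is additive on summable kernels — the Pi-sum shape
  `d120split` produces; the difference shape is the tree's `Beta.LimitRate.secondMoment_subKernel`); decay of differences is the tree's
  `T4RateAlgebra.decay510_add` ∕ `decay510_neg` (reused, not restated).
* §1 FROM `Definitions` ALONE: `polIV_eq_of_lastZero` (on last-zero histories the kernel Π_{k+1} is history-free: `d120` +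
  `d120split` + `d213`), `beta_eq_of_lastZero` (+ `d122`: so is β_{k+1}, on the last-zero face of the printed coupling domain
  `histDom`), `split_on_histDom` — THE SPLIT THE INTERFACE SUPPLIES: `∃ β⁰ : ℕ → ℝ, ∃ β¹, β = β⁰ + β¹ ∧ β¹ = 0 on the last-zero
  face of histDom`.  This is `B12Beta.OneLoopSplit` with `vanish` RELATIVISED to the printed coupling domain (preceding couplings
  in ]0, γ]): print defines β_{j+1}(g_j) only there ((1.22) p. 264 with Theorem 3's «0 < g_k ≦ γ»), and every row-D4 consumer reads
  histories in `B12Beta.HistBox γ ⊆ histDom γ`; off the domain the interface (faithfully) says nothing.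
* §2 ALONG RUNS, from `Definitions ∧ Conclusions` under Theorem 3's run hypothesis `RunHyp`: `lastSection_eq_secondMoment_add`
  (β_{j+1}(g₀, …, g_{j−1}, s) = Σ-moment of pol log Z^{(j)} + Σ-moment of pol 𝐄^{(j+1)}_int(…, s) — the β-LEVEL form of the
  kernel bookkeeping `d120split`, the two summabilities coming from `c118` + `c510` through
  `B12Sec2to5.secondMoment_abs_le_of_decay510`); `abs_lastSection_sub_zero_le` — N-D4-3's SECOND INSTANTIATION: if the
  interaction slot carries the (4.37)-representation with a constant `E′` along the run (`repr437 j (Eint j ·) E′`, a DISPLAYED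
  HYPOTHESIS — in print this constant is [Balaban1988RG2Cluster] (2.41)'s O(1)C₃ε₁, not a letter of [I]), then
  |β_{j+1}(…, s) − β_{j+1}(…, 0)| ≤ 2·C510·E′·Σ_x |x|₁² e^{−δ₁|x|₁} on [0, γ]; `oneLoopSplit_beta1_eq_sub` ∕ `oneLoopSplit_abs_beta1_le`
  — for any one-loop split of `S.β` the row may hold, its remainder along run sections IS that difference, hence so bounded.

* §3 THE (U)-LETTER ON RUNS: `abs_lastSection_le_betaPrime510` (the typer's `beta_abs_le_of_conclusions` by the name
  `B12Sec2to5.betaPrime510 4 (C510·E₀) δ₁` the row's consumers use) and `abs_beta_prefix_le_betaPrime510` — `FlowStep.BetaUpperH`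
  RESTRICTED TO RUN PREFIXES, the histories at which (0.20) reads β; the box-wide (U) is not supplied (O-2 below).

ROW IMPACT (BINDER-OWNERS row D4): class NONE — `B12BetaAsPrinted S` is a predicate on an abstract `Setting`, no instance of
Bałaban's objects is constructed (instance 0∕1; (D4) NOT discharged); wiring: the letters above are supplied BY NAME.  NOT
supplied (and not printed in [I]): the interaction-slot constant of [II] (2.41); the history-UNIFORM derivative letters (the
row's READINGS `BetaDerivClause.LastVarDerivBound`, `B12CouplingClausesHistory.BetaDerivsUniformInLast264`); any sign, lower
bound or value at 0 of β (Theorem 2, STATED WITHOUT PROOF — `B12BetaAsPrinted.Theorem2Statement`).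

QUANTIFIER SHAPE (observation O-2 of the row's first-refusal read, journal [AN4-G139-XREAD-1]): print's Theorem 3 — hence every
run-level field of `Conclusions` — speaks of the histories OF A RUN defined by (0.20), with only the LAST coupling varied over
[0, γ] (`sectionHist S P j s`; p. 263 «of g_{j−1} ∈ [0, γ]», p. 298).  The row's box-quantified letters (`Beta.RemainderChain.RemainderConst`
∕ `FlowStep.BetaUpperH` on `B12Beta.HistBox γ k`: EVERY history in ]0, γ]^{k+1}) therefore receive from the interface only their
restrictions to run sections (§2 below is stated that way); the free variation of the earlier couplings is a READING, not print.

statement-level skeleton of published theorems with citation tags; proofs where landed; nothing here is a claim about the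
Yang–Mills mass gap
-/

noncomputable section

namespace Summit.QuantumFields.BalabanUV.Beta.B12AsPrintedRowD4Junction

open Literature.MathematicalPhysics.QuantumFieldTheory.Balaban1983to89
open Literature.MathematicalPhysics.QuantumFieldTheory.Balaban1983to89.B12BetaAsPrinted
open Literature.MathematicalPhysics.QuantumFieldTheory.Balaban1983to89.B12Sec2to5 (Decay510 l1
  secondMoment_abs_le_of_decay510)
open Literature.MathematicalPhysics.QuantumFieldTheory.Balaban1983to89.B12Beta (Kernel secondMoment)
open Literature.MathematicalPhysics.QuantumFieldTheory.Balaban1983to89.T4RateAlgebra (decay510_add decay510_neg)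

/-! ## §0 Kernel bookkeeping -/

/-- The lattice sum (1.22) `Σ_x Π_{μν}(x) x_μ x_ν` is additive in the kernel when both sums converge absolutely (a `tsum`
identity). [folklore] -/
theorem secondMoment_add {d : ℕ} (K₁ K₂ : Kernel d) (μ ν : Fin d)
    (h₁ : Summable fun x : Fin d → ℤ => K₁ μ ν x * (x μ : ℝ) * (x ν : ℝ))
    (h₂ : Summable fun x : Fin d → ℤ => K₂ μ ν x * (x μ : ℝ) * (x ν : ℝ)) :
    secondMoment (K₁ + K₂) μ ν = secondMoment K₁ μ ν + secondMoment K₂ μ ν := by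
  unfold secondMoment
  rw [← h₁.tsum_add h₂]
  refine tsum_congr fun x => ?_
  simp only [Pi.add_apply]
  ring

/-! ## §1 From the printed DEFINITIONS alone: the split on the printed coupling domain -/

variable {S : Setting}

/-- N-D4-2 for the FULL kernel: on two histories whose last coupling vanishes, the polarization kernel Π_{k+1} of the run's
𝐄^{(k+1)} is the same — (1.20)∕(1.21) `d120`, the bookkeeping split `d120split` (pol 𝐄 = pol log Z + pol 𝐄_int) and p. 268's
sentence `d213` (at g_k = 0 the interaction slot depends on no coupling). [cite: Balaban1987RG1, (2.13)–(2.14) p.268 («vanishes at g_k = 0») with (1.20) p.264] -/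
theorem polIV_eq_of_lastZero (hD : Definitions S) {k : ℕ} {p p' : Fin (k + 1) → ℝ}
    (hp : p (Fin.last k) = 0) (hp' : p' (Fin.last k) = 0) : S.polIV k p = S.polIV k p' := by
  rw [hD.d120, hD.d120, hD.d120split, hD.d120split, hD.d213 k p p' hp hp']

/-- β_{k+1} IS HISTORY-FREE ON THE LAST-ZERO FACE OF THE PRINTED COUPLING DOMAIN: for two histories in `histDom S.γ k`
(preceding couplings in ]0, γ], last one in [0, γ]) with last coupling 0, β_{k+1} takes the same value — `polIV_eq_of_lastZero`
read through (1.22) `d122` at (μ, ν) = (0, 1).  This is the right member of (D4-J2) `exists_split_iff_lastZero`, relativised to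
`histDom`. [cite: Balaban1987RG1, (1.22) p.264 with (2.13)–(2.14) p.268] -/
theorem beta_eq_of_lastZero (hD : Definitions S) {k : ℕ} {p p' : Fin (k + 1) → ℝ}
    (hpD : p ∈ histDom S.γ k) (hp'D : p' ∈ histDom S.γ k)
    (hp : p (Fin.last k) = 0) (hp' : p' (Fin.last k) = 0) : S.β k p = S.β k p' := by
  have h01 : (0 : Fin 4) ≠ 1 := by decide
  rw [(hD.d122 k p hpD 0 1 h01).2, (hD.d122 k p' hp'D 0 1 h01).2, polIV_eq_of_lastZero hD hp hp']

/-- **THE SPLIT THE INTERFACE SUPPLIES (N-D4-1∕2 at β level).**  From the printed definitions alone there are numbers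
`β⁰_{k+1}` (one per scale) and a history-dependent remainder `β¹` with `β_{k+1} = β⁰_{k+1} + β¹_{k+1}(g₀, …, g_k)` everywhere and
`β¹_{k+1} = 0` on every history of the printed coupling domain whose last coupling is 0 — `B12Beta.OneLoopSplit`'s `split` and
`vanish`, the latter RELATIVISED to `histDom` (print defines β_{j+1}(g_j) for the preceding couplings in ]0, γ] only; off that
domain the interface says nothing).  `β⁰_{k+1}` := the value of β_{k+1} on the face (any point; `beta_eq_of_lastZero`), 0 if the
face is empty. [cite: Balaban1987RG1, (1.3)–(1.6) pp.260–261 with (2.13)–(2.14) p.268] -/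
theorem split_on_histDom (hD : Definitions S) :
    ∃ (β0 : ℕ → ℝ) (β1 : FlowStep.HBeta), (∀ (k : ℕ) (p : Fin (k + 1) → ℝ), S.β k p = β0 k + β1 k p) ∧
      ∀ (k : ℕ) (p : Fin (k + 1) → ℝ), p ∈ histDom S.γ k → p (Fin.last k) = 0 → β1 k p = 0 := by
  classical
  let β0 : ℕ → ℝ := fun k =>
    if h : ∃ q : Fin (k + 1) → ℝ, q ∈ histDom S.γ k ∧ q (Fin.last k) = 0 then S.β k h.choose else 0
  refine ⟨β0, fun k p => S.β k p - β0 k, fun k p => by ring, fun k p hpD hp => ?_⟩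
  have hex : ∃ q : Fin (k + 1) → ℝ, q ∈ histDom S.γ k ∧ q (Fin.last k) = 0 := ⟨p, hpD, hp⟩
  have hβ0 : β0 k = S.β k hex.choose := dif_pos hex
  show S.β k p - β0 k = 0
  rw [hβ0, beta_eq_of_lastZero hD hpD hex.choose_spec.1 hp hex.choose_spec.2, sub_self]

/-- Conversely, ANY one-loop split of `S.β` the row may hold (vanishing at every last-zero history, on or off the domain) has
its one-loop numbers forced by the interface: `β⁰_{k+1}` = the value of β_{k+1} at any last-zero history. [cite: Balaban1987RG1, (2.13)–(2.14) p.268] -/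
theorem oneLoopSplit_beta0_eq (T : B12Beta.OneLoopSplit S.β) {k : ℕ} {p : Fin (k + 1) → ℝ}
    (hp : p (Fin.last k) = 0) : T.β0 k = S.β k p := by
  rw [T.split k p, T.vanish k p hp, add_zero]

/-! ## §2 Along runs, from DEFINITIONS ∧ CONCLUSIONS: β = (one loop) + (interaction), and the remainder bound -/

/-- The history (g₀, …, g_{j−1}, 0) of a run has last coupling 0 (bookkeeping). [folklore] -/
theorem sectionHist_zero_last (S : Setting) (P : B12.RunParams) (j : ℕ) :
    sectionHist S P j 0 (Fin.last j) = 0 := by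
  simp [sectionHist]

/-- Under Theorem 3's run hypothesis, 0 ∈ [0, γ] (g₀ ∈ ]0, γ] forces 0 ≤ γ). [folklore] -/
theorem zero_mem_Icc_of_runHyp {P : B12.RunParams} (hP : RunHyp S P) : (0 : ℝ) ∈ Set.Icc (0 : ℝ) S.γ := by
  have h0 := hP.inInterval 0 (Nat.zero_le _)
  exact ⟨le_rfl, h0.1.le.trans h0.2⟩

/-- Along a run, at every last coupling s ∈ [0, γ]: the interaction-slot kernel decays at rate δ₁ with constant C510·E₀
(`c118` + the schema `c510`). [cite: Balaban1987RG1, (5.10) p.293 with (1.18) p.263] -/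
theorem decay_pol_Eint (hC : Conclusions S) {P : B12.RunParams} (hP : RunHyp S P) {j : ℕ} (hj : j + 1 ≤ P.K)
    {s : ℝ} (hs : s ∈ Set.Icc (0 : ℝ) S.γ) (μ ν : Fin 4) :
    Decay510 (S.pol j (S.Eint j (sectionHist S P j s)) μ ν) (S.C510 * S.E₀) S.δ₁ :=
  hC.c510.2 j _ _ (hC.c118 P hP j hj s hs).2 μ ν

/-- Along a run: the full kernel Π_{j+1}(…, s) decays at rate δ₁ with constant C510·E₀ (`d120` + `c118` + `c510`; the displayed
instance of (5.10)). [cite: Balaban1987RG1, (5.10) p.293 with (1.18) p.263 and (1.20) p.264] -/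
theorem decay_polIV (hD : Definitions S) (hC : Conclusions S) {P : B12.RunParams} (hP : RunHyp S P) {j : ℕ}
    (hj : j + 1 ≤ P.K) {s : ℝ} (hs : s ∈ Set.Icc (0 : ℝ) S.γ) (μ ν : Fin 4) :
    Decay510 (S.polIV j (sectionHist S P j s) μ ν) (S.C510 * S.E₀) S.δ₁ := by
  rw [hD.d120]
  exact hC.c510.2 j _ _ (hC.c118 P hP j hj s hs).1 μ ν

/-- The zeroth-order kernel is a difference of the two bounded ones: pol log Z^{(j)} = pol 𝐄^{(j+1)} − pol 𝐄^{(j+1)}_int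
(`d120split`), componentwise. [cite: Balaban1987RG1, (1.3)–(1.6) pp.260–261 with (1.20) p.264] -/
theorem pol_logZ_apply_eq_sub (hD : Definitions S) (j : ℕ) (p : Fin (j + 1) → ℝ) (μ ν : Fin 4) :
    S.pol j (S.logZ j) μ ν = S.pol j (S.Ebold j p) μ ν - S.pol j (S.Eint j p) μ ν := by
  rw [hD.d120split]
  funext x
  simp [Pi.add_apply, Pi.sub_apply]

/-- Along a run: the zeroth-order kernel pol log Z^{(j)} decays at rate δ₁ with constant 2·C510·E₀ (`pol_logZ_apply_eq_sub` through the
tree's `T4RateAlgebra.decay510_add` ∕ `decay510_neg`). [cite: Balaban1987RG1, (5.10) p.293 with (1.3)–(1.6) pp.260–261] -/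
theorem decay_pol_logZ (hD : Definitions S) (hC : Conclusions S) {P : B12.RunParams} (hP : RunHyp S P) {j : ℕ}
    (hj : j + 1 ≤ P.K) {s : ℝ} (hs : s ∈ Set.Icc (0 : ℝ) S.γ) (μ ν : Fin 4) :
    Decay510 (S.pol j (S.logZ j) μ ν) (S.C510 * S.E₀ + S.C510 * S.E₀) S.δ₁ := by
  have hZ := pol_logZ_apply_eq_sub hD j (sectionHist S P j s) μ ν
  have hB : Decay510 (S.pol j (S.Ebold j (sectionHist S P j s)) μ ν) (S.C510 * S.E₀) S.δ₁ :=
    hC.c510.2 j _ _ (hC.c118 P hP j hj s hs).1 μ ν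
  exact decay510_add hB (decay510_neg (decay_pol_Eint hC hP hj hs μ ν)) fun x => by
    rw [hZ, Pi.sub_apply, sub_eq_add_neg]

/-- **β = (ONE LOOP) + (INTERACTION) AT β LEVEL, along a run** (the β-level form of the kernel bookkeeping `d120split`, N-D4-1):
for every run defined by (0.20) with 0 < g_k ≦ γ (k ≤ K), every step j + 1 ≤ K, every last coupling s ∈ [0, γ] and every μ ≠ ν,
β_{j+1}(g₀, …, g_{j−1}, s) = Σ_x (pol log Z^{(j)})_{μν}(x) x_μ x_ν + Σ_x (pol 𝐄^{(j+1)}_int(…, s))_{μν}(x) x_μ x_ν — the two lattice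
sums converging absolutely by (5.10) (`decay_pol_logZ`, `decay_pol_Eint`, `B12Sec2to5.secondMoment_abs_le_of_decay510`).  The
first summand carries NO coupling (the row's β⁰-source), the second is the row's β¹-source up to its (history-free) value at
s = 0. [cite: Balaban1987RG1, (1.22) p.264 with (1.3)–(1.6) pp.260–261 and (5.10) p.293] -/
theorem lastSection_eq_secondMoment_add (hD : Definitions S) (hC : Conclusions S) {P : B12.RunParams}
    (hP : RunHyp S P) {j : ℕ} (hj : j + 1 ≤ P.K) {s : ℝ} (hs : s ∈ Set.Icc (0 : ℝ) S.γ) {μ ν : Fin 4}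
    (hμν : μ ≠ ν) :
    lastSection S P j s =
      secondMoment (S.pol j (S.logZ j)) μ ν + secondMoment (S.pol j (S.Eint j (sectionHist S P j s))) μ ν := by
  have hβ := (hD.d122 j _ (sectionHist_mem_histDom hP.inInterval hj hs) μ ν hμν).2
  rw [lastSection_eq, hβ, hD.d120, hD.d120split]
  exact secondMoment_add _ _ μ ν
    (secondMoment_abs_le_of_decay510 hC.c510.1 (decay_pol_logZ hD hC hP hj hs μ ν)).1
    (secondMoment_abs_le_of_decay510 hC.c510.1 (decay_pol_Eint hC hP hj hs μ ν)).1

/-- **N-D4-3's SECOND INSTANTIATION — the remainder bound the interface yields.**  If, along the run, the INTERACTION slot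
𝐄^{(j+1)}_int(…, s) carries the (4.37)-representation with (1.18)-type constant `E′` for every s ∈ [0, γ] (a DISPLAYED
HYPOTHESIS: print's constant here is [Balaban1988RG2Cluster] (2.41)'s O(1)C₃ε₁, not a letter of [I]), then the (5.10)-schema
`c510` gives |β_{j+1}(…, s) − β_{j+1}(…, 0)| ≦ 2·C510·E′·Σ_x |x|₁² e^{−δ₁|x|₁} for every s ∈ [0, γ] — the one-loop parts cancel
(`lastSection_eq_secondMoment_add`) and each interaction moment is bounded by `B12Sec2to5.secondMoment_abs_le_of_decay510`.
[cite: Balaban1987RG1, (5.10) p.293 with (1.22) p.264 and (2.13)–(2.14) p.268] -/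
theorem abs_lastSection_sub_zero_le (hD : Definitions S) (hC : Conclusions S) {P : B12.RunParams} (hP : RunHyp S P)
    {j : ℕ} (hj : j + 1 ≤ P.K) {E' : ℝ}
    (hE' : ∀ s ∈ Set.Icc (0 : ℝ) S.γ, S.repr437 j (S.Eint j (sectionHist S P j s)) E')
    {s : ℝ} (hs : s ∈ Set.Icc (0 : ℝ) S.γ) :
    |lastSection S P j s - lastSection S P j 0| ≤
      2 * (S.C510 * E') * ∑' x : Fin 4 → ℤ, l1 x ^ 2 * Real.exp (-S.δ₁ * l1 x) := by
  have h0 : (0 : ℝ) ∈ Set.Icc (0 : ℝ) S.γ := zero_mem_Icc_of_runHyp hP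
  have h01 : (0 : Fin 4) ≠ 1 := by decide
  rw [lastSection_eq_secondMoment_add hD hC hP hj hs h01, lastSection_eq_secondMoment_add hD hC hP hj h0 h01,
    add_sub_add_left_eq_sub]
  have bs := (secondMoment_abs_le_of_decay510 (μ := 0) (ν := 1) hC.c510.1 (hC.c510.2 j _ _ (hE' s hs) 0 1)).2
  have b0 := (secondMoment_abs_le_of_decay510 (μ := 0) (ν := 1) hC.c510.1 (hC.c510.2 j _ _ (hE' 0 h0) 0 1)).2
  calc |secondMoment (S.pol j (S.Eint j (sectionHist S P j s))) 0 1 -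
          secondMoment (S.pol j (S.Eint j (sectionHist S P j 0))) 0 1|
        ≤ |secondMoment (S.pol j (S.Eint j (sectionHist S P j s))) 0 1| +
          |secondMoment (S.pol j (S.Eint j (sectionHist S P j 0))) 0 1| := abs_sub _ _
    _ ≤ S.C510 * E' * ∑' x : Fin 4 → ℤ, l1 x ^ 2 * Real.exp (-S.δ₁ * l1 x) +
          S.C510 * E' * ∑' x : Fin 4 → ℤ, l1 x ^ 2 * Real.exp (-S.δ₁ * l1 x) := add_le_add bs b0
    _ = 2 * (S.C510 * E') * ∑' x : Fin 4 → ℤ, l1 x ^ 2 * Real.exp (-S.δ₁ * l1 x) := by ring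

/-- For any one-loop split `T` of `S.β` (the row's structure; `vanish` at every last-zero history), the remainder read along
a run section IS the difference β_{j+1}(…, s) − β_{j+1}(…, 0). [cite: Balaban1987RG1, (2.13)–(2.14) p.268 with p.298] -/
theorem oneLoopSplit_beta1_eq_sub (T : B12Beta.OneLoopSplit S.β) (P : B12.RunParams) (j : ℕ) (s : ℝ) :
    T.β1 j (sectionHist S P j s) = lastSection S P j s - lastSection S P j 0 := by
  have hv : T.β1 j (sectionHist S P j 0) = 0 := T.vanish j _ (sectionHist_zero_last S P j)
  rw [lastSection_eq, lastSection_eq, T.split j (sectionHist S P j s), T.split j (sectionHist S P j 0), hv]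
  ring

/-- Hence, GIVEN the second instantiation `E′` of the interaction slot, every one-loop split of `S.β` has its remainder bounded
along run sections: |β¹_{j+1}(g₀, …, g_{j−1}, s)| ≦ 2·C510·E′·Σ_x |x|₁² e^{−δ₁|x|₁}, s ∈ [0, γ] — the shape of the row's letter
`Beta.RemainderChain.Chain.abs_beta1_le` restricted to run histories, with the constant print would give it.
[cite: Balaban1987RG1, (5.10) p.293 with (2.13)–(2.14) p.268] -/
theorem oneLoopSplit_abs_beta1_le (T : B12Beta.OneLoopSplit S.β) (hD : Definitions S) (hC : Conclusions S)
    {P : B12.RunParams} (hP : RunHyp S P) {j : ℕ} (hj : j + 1 ≤ P.K) {E' : ℝ}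
    (hE' : ∀ s ∈ Set.Icc (0 : ℝ) S.γ, S.repr437 j (S.Eint j (sectionHist S P j s)) E')
    {s : ℝ} (hs : s ∈ Set.Icc (0 : ℝ) S.γ) :
    |T.β1 j (sectionHist S P j s)| ≤ 2 * (S.C510 * E') * ∑' x : Fin 4 → ℤ, l1 x ^ 2 * Real.exp (-S.δ₁ * l1 x) := by
  rw [oneLoopSplit_beta1_eq_sub]
  exact abs_lastSection_sub_zero_le hD hC hP hj hE' hs

/-! ## §3 The (U)-letter the interface supplies — on run sections and run prefixes (O-2) -/

/-- The typer's undisplayed line `beta_abs_le_of_conclusions` BY THE NAME the row's consumers use: along a run, at every last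
coupling s ∈ [0, γ], |β_{j+1}(g₀, …, g_{j−1}, s)| ≦ β′ with β′ = `B12Sec2to5.betaPrime510 4 (C510·E₀) δ₁` (the constant of
`B12Sec2to5.betaUpper_of_decay510`; p. 264 «uniformly bounded on this interval», constant unnamed in print). [cite: Balaban1987RG1, (5.10) p.293 with (5.42) p.297 and p.264 («uniformly bounded»)] -/
theorem abs_lastSection_le_betaPrime510 (hD : Definitions S) (hC : Conclusions S) {P : B12.RunParams} (hP : RunHyp S P)
    {j : ℕ} (hj : j + 1 ≤ P.K) {s : ℝ} (hs : s ∈ Set.Icc (0 : ℝ) S.γ) :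
    |lastSection S P j s| ≤ B12Sec2to5.betaPrime510 4 (S.C510 * S.E₀) S.δ₁ := by
  have h01 : (0 : Fin 4) ≠ 1 := by decide
  unfold B12Sec2to5.betaPrime510
  exact beta_abs_le_of_conclusions hD hC hP hj hs h01

/-- **`FlowStep.BetaUpperH` RESTRICTED TO RUN PREFIXES — what print's Theorem 3 gives of the row's (U)-letter.**  For every run
defined by (0.20) with 0 < g_k ≦ γ (k ≤ K) and every step j + 1 ≤ K: |β_{j+1}(g₀, …, g_j)| ≦ β′ at the run's OWN history
`prefixOf (S.cpl P) j` — the only histories at which the recursion (0.20) (`RunHyp.rg`, `FlowStep.RGEqH`) reads β.  The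
box-wide `BetaUpperH β′ γ S.β` (every history in ]0, γ]^{j+1}) is NOT supplied by an [I]-interface (observation O-2).
[cite: Balaban1987RG1, Thm 3 p.264 with (5.10) p.293 and (5.42) p.297] -/
theorem abs_beta_prefix_le_betaPrime510 (hD : Definitions S) (hC : Conclusions S) {P : B12.RunParams} (hP : RunHyp S P)
    {j : ℕ} (hj : j + 1 ≤ P.K) :
    |S.β j (FlowStep.prefixOf (S.cpl P) j)| ≤ B12Sec2to5.betaPrime510 4 (S.C510 * S.E₀) S.δ₁ := by
  have hg := hP.inInterval j (le_trans (Nat.le_succ j) hj)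
  have hs : S.cpl P j ∈ Set.Icc (0 : ℝ) S.γ := ⟨hg.1.le, hg.2⟩
  have h := abs_lastSection_le_betaPrime510 hD hC hP hj hs
  rwa [lastSection_eq, sectionHist_self] at h

end Summit.QuantumFields.BalabanUV.Beta.B12AsPrintedRowD4Junction

end
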